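import Literature.NumberTheory.EllipticCurves.SupersingularPPowerTorsionKernelOfReductionProofs
import Literature.NumberTheory.EllipticCurves.SelmerFiniteProofs
import HarnessLib

/-!
# The supersingular SHAPE of the `p`-division polynomials at a place of good supersingular
# reduction — all primes `p` (Debry for odd `p`; `a₁ = 0` for `p = 2`), in the spectral valuation
# of `K̄_v` (proofs only)

`Proofs`-style file (THEOREMS ONLY), topic `NumberTheory/EllipticCurves`, paper group `Serre1967`
(inputs of the torsion form of Serre, Driebergen 1966, §5 Prop. 8). For a Weierstrass equation `E`
over a number field `K` and a finite place `v ∋ p` with `E.HasGoodReductionAt v` and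
`¬ E.HasUnitRootAt v` (good SUPERSINGULAR reduction), let `M = E.localMinimalIntegralModel v` over
`𝒪_v` and `V = (E.localMinimalModel v) ⊗ K̄_v`, `|·|_v` the spectral valuation of `K̄_v`. Then
(`exists_shape_ΨSq_localMinimalModel_baseChange`) there is `μ < 1` with

  `|coeff_j Φ_p(V)|_v ≤ 1` (all `j`), `|coeff₀ ΨSq_p(V)|_v = 1`, `|coeff_j ΨSq_p(V)|_v ≤ μ` (`j ≥ 1`),

the hypotheses of the tree's `valuation_X_pow_sq_le_or_le_mul_of_zsmul_eq` (Serre's contraction),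
`one_lt_valuation_X_of_prime_pow_zsmul_eq_zero_of_ΨSq_shape` (`E[p^∞] ⊆ E₁`) and
`Serre1967.eq_bot_of_stable_divisible_of_contraction`. Ingredients: for odd `p`, `ΨSq_p` of the
supersingular reduction is a non-zero constant (Debry; tree
`coeff_ΨSq_prime_localMinimalIntegralModel_mem_maximalIdeal`, completed here by
`coeff_ΨSq_prime_zero_not_mem_maximalIdeal_of_hasseCoeff_residue_eq_zero`); for `p = 2`, a
supersingular curve over a finite field of characteristic `2` (odd number of points) has `a₁ = 0`
(tree `a₁_eq_zero_of_odd_natCard_point`), whence `ΨSq₂ = Ψ₂² = 4x³ + b₂x² + 2b₄x + b₆ = a₃²` is a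
non-zero constant (`ΨSq_two_eq_C_of_a₁_eq_zero`; `Δ = a₃⁴ ≠ 0`).

## References

* J.-P. Serre, Proc. Conf. Local Fields (Driebergen 1966), Springer 1967, §5. [Serre1967GroupesPDivisibles]
* J. H. Silverman, *The Arithmetic of Elliptic Curves*, 2nd ed. (2009), III.1, Exercise 3.7,
  V.3.1(a), V.4.1, A.1.1 (characteristic `2`). [SilvermanAEC2009]
-/

noncomputable section

open scoped Classical NNReal

namespace WeierstrassCurve

open Polynomial Literature.NumberTheory.EllipticCurves NumberField IsDedekindDomain IsLocalRing

/-! ### Characteristic `2`: `a₁ = 0 ⇒ ΨSq₂ = a₃²`, a non-zero constant -/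

section CharTwo

variable {R : Type*} [CommRing R] [CharP R 2] (W : WeierstrassCurve R)

/-- In characteristic `2` with `a₁ = 0`: `ΨSq₂ = Ψ₂² = 4x³ + b₂x² + 2b₄x + b₆ = C(a₃²)`
(`b₂ = a₁² + 4a₂ = 0`, `b₆ = a₃² + 4a₆ = a₃²`). [cite: SilvermanAEC2009, III.1 and A.1.1] -/
theorem ΨSq_two_eq_C_of_a₁_eq_zero (h : W.a₁ = 0) : W.ΨSq 2 = C (W.a₃ ^ 2) := by
  have h2 : (2 : R) = 0 := by simpa using CharP.cast_eq_zero R 2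
  have h4 : (4 : R) = 0 := by
    have : (4 : R) = 2 * 2 := by norm_num
    rw [this, h2, mul_zero]
  have hb₂ : W.b₂ = 0 := by rw [b₂, h, h4]; ring
  have hb₄ : 2 * W.b₄ = 0 := by rw [h2, zero_mul]
  have hb₆ : W.b₆ = W.a₃ ^ 2 := by rw [b₆, h4]; ring
  have e : W.ΨSq 2 = W.Ψ₂Sq := by exact_mod_cast W.ΨSq_two
  rw [e, Ψ₂Sq, hb₂, hb₄, hb₆, h4]
  simp

/-- In characteristic `2` with `a₁ = 0`, `Δ = a₃⁴`; so an elliptic `W` has `a₃² ≠ 0`.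
[cite: SilvermanAEC2009, A.1.1] -/
theorem a₃_sq_ne_zero_of_a₁_eq_zero [Nontrivial R] [W.IsElliptic] (h : W.a₁ = 0) :
    W.a₃ ^ 2 ≠ 0 := by
  have h2 : (2 : R) = 0 := by simpa using CharP.cast_eq_zero R 2
  have hΔ : W.Δ = (W.a₃ ^ 2) ^ 2 := by
    simp only [Δ, b₂, b₄, b₆, b₈, h]
    linear_combination (-14 * W.a₃ ^ 4 - 32 * W.a₂ ^ 3 * W.a₆ - 8 * W.a₂ ^ 3 * W.a₃ ^ 2
      + 8 * W.a₂ ^ 2 * W.a₄ ^ 2 - 32 * W.a₄ ^ 3 - 108 * W.a₃ ^ 2 * W.a₆ - 216 * W.a₆ ^ 2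
      + 36 * W.a₂ * W.a₃ ^ 2 * W.a₄ + 144 * W.a₂ * W.a₄ * W.a₆) * h2
  intro h0
  apply W.isUnit_Δ.ne_zero
  rw [hΔ, h0, zero_pow two_ne_zero]

end CharTwo

/-! ### Local rings with finite residue field -/

section LocalRing

variable {R : Type*} [CommRing R] [IsLocalRing R] [Finite (ResidueField R)] (M : WeierstrassCurve R)
  (p : ℕ) [hp : Fact p.Prime] [CharP (ResidueField R) p]

/-- Odd `p`, supersingular reduction (`A_p = 0`): the CONSTANT coefficient of `ΨSq_p(M)` is a unit of
`R` (`ΨSq_p ≡ c ≢ 0 (mod 𝔪)`, Debry's criterion, tree `exists_ΨSq_prime_eq_C_of_hasseCoeff_eq_zero`).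
[cite: SilvermanAEC2009, Exercise 3.7(f) and V.3.1(a)] -/
theorem coeff_ΨSq_prime_zero_not_mem_maximalIdeal_of_hasseCoeff_residue_eq_zero (hp2 : p ≠ 2)
    [hE : (M.map (residue R)).IsElliptic] (hA : (M.map (residue R)).hasseCoeff p = 0) :
    (M.ΨSq (p : ℤ)).coeff 0 ∉ maximalIdeal R := by
  letI : Fintype (ResidueField R) := Fintype.ofFinite _
  obtain ⟨c, hc0, hc⟩ := (M.map (residue R)).exists_ΨSq_prime_eq_C_of_hasseCoeff_eq_zero p hp2 hA
  rw [← residue_eq_zero_iff, ← Polynomial.coeff_map, ← map_ΨSq, hc, coeff_C_zero]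
  exact hc0

/-- `p = 2`, supersingular reduction (odd number of points): `ΨSq₂(M) ≡ a₃² ≢ 0 (mod 𝔪)` — the
constant coefficient is a unit and the others lie in `𝔪` (`a₁ ≡ 0`, tree
`a₁_eq_zero_of_odd_natCard_point`). [cite: SilvermanAEC2009, A.1.1 and V.3.1(a)] -/
theorem coeff_ΨSq_two_shape_of_odd_natCard_point (hp : p = 2) [hE : (M.map (residue R)).IsElliptic]
    (hodd : Odd (Nat.card (M.map (residue R)).toAffine.Point)) :
    (M.ΨSq (2 : ℤ)).coeff 0 ∉ maximalIdeal R ∧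
      ∀ j, 1 ≤ j → (M.ΨSq (2 : ℤ)).coeff j ∈ maximalIdeal R := by
  subst hp
  letI : Fintype (ResidueField R) := Fintype.ofFinite _
  have ha₁ : (M.map (residue R)).a₁ = 0 := (M.map (residue R)).a₁_eq_zero_of_odd_natCard_point hodd
  have hΨ : (M.map (residue R)).ΨSq 2 = C ((M.map (residue R)).a₃ ^ 2) :=
    (M.map (residue R)).ΨSq_two_eq_C_of_a₁_eq_zero ha₁
  have hΨ' : (M.map (residue R)).ΨSq (2 : ℤ) = C ((M.map (residue R)).a₃ ^ 2) := by
    exact_mod_cast hΨ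
  have ha₃ := (M.map (residue R)).a₃_sq_ne_zero_of_a₁_eq_zero ha₁
  refine ⟨?_, fun j hj => ?_⟩
  · rw [← residue_eq_zero_iff, ← Polynomial.coeff_map, ← map_ΨSq, hΨ', coeff_C_zero]
    exact ha₃
  · rw [← residue_eq_zero_iff, ← Polynomial.coeff_map, ← map_ΨSq, hΨ', coeff_C, if_neg (by omega)]

end LocalRing

/-! ### Number fields: the local minimal integral model at a good supersingular place (all `p`) -/

section NumberField

variable {K : Type*} [Field K] [NumberField K] (E : WeierstrassCurve K)
  (v : HeightOneSpectrum (𝓞 K)) {p : ℕ} [hp : Fact p.Prime]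

/-- **At a place `v ∋ p` of good SUPERSINGULAR reduction (`HasGoodReductionAt v`, `¬ HasUnitRootAt v`)
the `p`-division polynomial `ΨSq_p` of the local minimal integral model has UNIT constant coefficient
and all other coefficients in `𝔪_v`** — every prime `p` (odd `p`: Debry's criterion via the Hasse
invariant; `p = 2`: `a₁ ≡ 0`). [cite: SilvermanAEC2009, V.3.1(a) and Exercise 3.7(f)] -/
theorem coeff_ΨSq_localMinimalIntegralModel_shape (hv : (p : 𝓞 K) ∈ v.asIdeal)
    (hgood : E.HasGoodReductionAt v) (hss : ¬ E.HasUnitRootAt v) :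
    ((E.localMinimalIntegralModel v).ΨSq (p : ℤ)).coeff 0 ∉ maximalIdeal (v.adicCompletionIntegers K) ∧
      ∀ j, 1 ≤ j → ((E.localMinimalIntegralModel v).ΨSq (p : ℤ)).coeff j ∈
        maximalIdeal (v.adicCompletionIntegers K) := by
  set O := v.adicCompletionIntegers K with hO
  set k := ResidueField O with hk
  letI : Fintype k := Fintype.ofFinite k
  have hchar : ringChar k = p := ringChar_residueField_eq v hp.out hv
  haveI : CharP k p := ringChar.of_eq hchar
  have hred : (E.localMinimalModel v).reduction O = (E.localMinimalIntegralModel v).map (residue O) := rfl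
  haveI hEll : ((E.localMinimalIntegralModel v).map (residue O)).IsElliptic := by
    rw [← hred]; exact (hasGoodReduction_iff_isElliptic_reduction (R := O)).mp hgood
  have hdvd : (p : ℤ) ∣ (Fintype.card k : ℤ) + 1 -
      Nat.card ((E.localMinimalIntegralModel v).map (residue O)).toAffine.Point := by
    have h := hss
    rw [hasUnitRootAt_iff, not_not, hchar, Nat.card_eq_fintype_card] at h
    rw [← hred]; exact h
  by_cases hp2 : p = 2
  · subst hp2
    -- `#k` is even, so `#Ẽ(k)` is odd
    obtain ⟨n, -, hn⟩ := FiniteField.card k 2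
    have heven : Even (Fintype.card k) := by
      rw [hn]; exact (Nat.even_pow).mpr ⟨even_two, n.pos.ne'⟩
    have hodd : Odd (Nat.card ((E.localMinimalIntegralModel v).map (residue O)).toAffine.Point) := by
      obtain ⟨c, hc⟩ := hdvd
      rw [← Nat.not_even_iff_odd]
      intro hev
      have h1 : (2 : ℤ) ∣
          (Nat.card ((E.localMinimalIntegralModel v).map (residue O)).toAffine.Point : ℤ) := by
        exact_mod_cast hev.two_dvd
      have h2 : (2 : ℤ) ∣ (Fintype.card k : ℤ) := by exact_mod_cast heven.two_dvd
      have h3 : (2 : ℤ) ∣ 1 := by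
        have e : (1 : ℤ) = ((Fintype.card k : ℤ) + 1 -
            Nat.card ((E.localMinimalIntegralModel v).map (residue O)).toAffine.Point) -
            Fintype.card k + Nat.card ((E.localMinimalIntegralModel v).map (residue O)).toAffine.Point := by
          ring
        rw [e, hc]
        exact dvd_add (dvd_sub (dvd_mul_right _ c) h2) h1
      omega
    exact coeff_ΨSq_two_shape_of_odd_natCard_point (E.localMinimalIntegralModel v) 2 rfl hodd
  · have hA : ((E.localMinimalIntegralModel v).map (residue O)).hasseCoeff p = 0 :=
      hasseCoeff_eq_zero_of_dvd_card_add_one_sub_natCard_point _ p hp2 hdvd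
    exact ⟨coeff_ΨSq_prime_zero_not_mem_maximalIdeal_of_hasseCoeff_residue_eq_zero _ p hp2 hA,
      fun j hj => coeff_ΨSq_prime_mem_maximalIdeal_of_hasseCoeff_residue_eq_zero _ p hp2 hA hj⟩

end NumberField

/-! ### The shape in the spectral valuation of `K̄_v` -/

section Spectral

variable {K : Type*} [Field K] [NumberField K] (E : WeierstrassCurve K)
  (v : HeightOneSpectrum (𝓞 K)) {p : ℕ} [hp : Fact p.Prime]
  {w : Valuation (AlgebraicClosure (v.adicCompletion K)) ℝ≥0}
  (hw : ∀ x, (w x : ℝ) =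
    spectralNorm (v.adicCompletion K) (AlgebraicClosure (v.adicCompletion K)) x)
include hw

omit hw in
/-- Coefficients of the division polynomials of `V = (E.localMinimalModel v) ⊗ K̄_v` are the images of
those of the local minimal integral model. Private plumbing. [folklore] -/
private theorem coeff_Φ_ΨSq_baseChange_eq (n : ℤ) (j : ℕ) :
    (((E.localMinimalModel v).baseChange (AlgebraicClosure (v.adicCompletion K))).Φ n).coeff j =
        algebraMap (v.adicCompletion K) (AlgebraicClosure (v.adicCompletion K))
          ((((E.localMinimalIntegralModel v).Φ n).coeff j : v.adicCompletionIntegers K) :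
            v.adicCompletion K) ∧
      (((E.localMinimalModel v).baseChange (AlgebraicClosure (v.adicCompletion K))).ΨSq n).coeff j =
        algebraMap (v.adicCompletion K) (AlgebraicClosure (v.adicCompletion K))
          ((((E.localMinimalIntegralModel v).ΨSq n).coeff j : v.adicCompletionIntegers K) :
            v.adicCompletion K) := by
  have hM : E.localMinimalModel v =
      (E.localMinimalIntegralModel v).map (algebraMap (v.adicCompletionIntegers K) (v.adicCompletion K)) :=
    (baseChange_integralModel_eq (v.adicCompletionIntegers K) (E.localMinimalModel v)).symm
  constructor
  · rw [baseChange, map_Φ, Polynomial.coeff_map, hM, map_Φ, Polynomial.coeff_map]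
    rfl
  · rw [baseChange, map_ΨSq, Polynomial.coeff_map, hM, map_ΨSq, Polynomial.coeff_map]
    rfl

/-- The spectral valuation of (the image of) an element of `𝓞_v`: `≤ 1`; `< 1` iff in `𝔪_v`.
Private plumbing. [folklore] -/
private theorem spectral_le_one_and_lt_one_iff (c : v.adicCompletionIntegers K) :
    w (algebraMap (v.adicCompletion K) (AlgebraicClosure (v.adicCompletion K)) (c : v.adicCompletion K))
        ≤ 1 ∧
      (w (algebraMap (v.adicCompletion K) (AlgebraicClosure (v.adicCompletion K))
          (c : v.adicCompletion K)) < 1 ↔ c ∈ maximalIdeal (v.adicCompletionIntegers K)) := by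
  refine ⟨(IsDedekindDomain.HeightOneSpectrum.spectralValuation_algebraMap_le_one_iff hw _).mpr c.2, ?_⟩
  rw [← NNReal.coe_lt_coe, IsDedekindDomain.HeightOneSpectrum.coe_spectralValuation_algebraMap hw,
    NNReal.coe_one, Valued.toNormedField.norm_lt_one_iff, IsLocalRing.mem_maximalIdeal, mem_nonunits_iff,
    HeightOneSpectrum.adicCompletionIntegers.isUnit_iff_valued_eq_one]
  have hle : Valued.v (c : v.adicCompletion K) ≤ 1 :=
    (HeightOneSpectrum.mem_adicCompletionIntegers (𝓞 K) K v).mp c.2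
  exact ⟨fun h => h.ne, fun h => lt_of_le_of_ne hle h⟩

/-- **The supersingular shape of the `p`-division polynomials in the spectral valuation of `K̄_v`.**
For `E/K`, a finite place `v ∋ p` with `E.HasGoodReductionAt v` and `¬ E.HasUnitRootAt v`, and
`V = (E.localMinimalModel v) ⊗ K̄_v`: there is `μ < 1` with `|coeff_j Φ_p(V)|_v ≤ 1` (all `j`),
`|coeff₀ ΨSq_p(V)|_v = 1` and `|coeff_j ΨSq_p(V)|_v ≤ μ` for `j ≥ 1` — every prime `p`.
[cite: SilvermanAEC2009, V.3.1(a) and Exercise 3.7] -/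
theorem exists_shape_ΨSq_localMinimalModel_baseChange (hv : (p : 𝓞 K) ∈ v.asIdeal)
    (hgood : E.HasGoodReductionAt v) (hss : ¬ E.HasUnitRootAt v) :
    ∃ μ : ℝ≥0, μ < 1 ∧
      (∀ j, w ((((E.localMinimalModel v).baseChange (AlgebraicClosure (v.adicCompletion K))).Φ p).coeff j)
        ≤ 1) ∧
      w ((((E.localMinimalModel v).baseChange (AlgebraicClosure (v.adicCompletion K))).ΨSq p).coeff 0)
        = 1 ∧
      ∀ j, 1 ≤ j →
        w ((((E.localMinimalModel v).baseChange (AlgebraicClosure (v.adicCompletion K))).ΨSq p).coeff j)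
          ≤ μ := by
  set V := (E.localMinimalModel v).baseChange (AlgebraicClosure (v.adicCompletion K)) with hV
  obtain ⟨h0, hj⟩ := E.coeff_ΨSq_localMinimalIntegralModel_shape v hv hgood hss
  -- the bound `μ`
  set μ : ℝ≥0 := (Finset.Icc 1 (p ^ 2)).sup fun j => w ((V.ΨSq (p : ℤ)).coeff j) with hμ
  have hlt : ∀ j, 1 ≤ j → w ((V.ΨSq (p : ℤ)).coeff j) < 1 := by
    intro j hj1
    rw [hV, (coeff_Φ_ΨSq_baseChange_eq E v (p : ℤ) j).2]
    exact ((spectral_le_one_and_lt_one_iff v hw _).2).mpr (hj j hj1)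
  refine ⟨μ, ?_, fun j => ?_, ?_, fun j hj1 => ?_⟩
  · rw [hμ, Finset.sup_lt_iff (show (⊥ : ℝ≥0) < 1 from zero_lt_one)]
    intro j hjm
    exact hlt j (Finset.mem_Icc.mp hjm).1
  · rw [hV, (coeff_Φ_ΨSq_baseChange_eq E v (p : ℤ) j).1]
    exact (spectral_le_one_and_lt_one_iff v hw _).1
  · rw [hV, (coeff_Φ_ΨSq_baseChange_eq E v (p : ℤ) 0).2]
    have h1 := (spectral_le_one_and_lt_one_iff v hw
      (((E.localMinimalIntegralModel v).ΨSq (p : ℤ)).coeff 0)).1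
    have h2 : ¬ (w (algebraMap (v.adicCompletion K) (AlgebraicClosure (v.adicCompletion K))
        ((((E.localMinimalIntegralModel v).ΨSq (p : ℤ)).coeff 0 : v.adicCompletionIntegers K) :
          v.adicCompletion K)) < 1) := fun hlt1 =>
      h0 (((spectral_le_one_and_lt_one_iff v hw _).2).mp hlt1)
    exact le_antisymm h1 (not_lt.mp h2)
  · by_cases hjp : j ≤ p ^ 2
    · rw [hμ]
      exact Finset.le_sup (f := fun j => w ((V.ΨSq (p : ℤ)).coeff j)) (Finset.mem_Icc.mpr ⟨hj1, hjp⟩)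
    · have hdeg : (V.ΨSq (p : ℤ)).natDegree < j := by
        have h := V.natDegree_ΨSq_le (p : ℤ)
        rw [Int.natAbs_natCast] at h
        omega
      rw [Polynomial.coeff_eq_zero_of_natDegree_lt hdeg, map_zero]
      exact bot_le

end Spectral

end WeierstrassCurve

end
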